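import Mathlib
import Summits.NavierStokesRegularity.NavierStokesRegularity.Theorems.EulerZoomLiouvillePowerGaugeEulerLiouvilleCondenserSharpExplicitGap
import Summits.NavierStokesRegularity.NavierStokesRegularity.Theorems.EulerZoomLiouvillePowerGaugeEulerLiouvilleCondenserShellCondenserGaugeForm
import Summits.NavierStokesRegularity.NavierStokesRegularity.Theorems.EulerZoomLiouvillePowerGaugeEulerLiouvilleCondenserTelescopingBudget

/-!
# THEOREM K″ — EXPLICIT-GAP LIOUVILLE, ALL-LARGE-RADII FORM, THRESHOLD `κ⋆⋆(c,ρ) = 2π/((1−ρ)²(2+ρ)c) = 3κ⋆/(1−ρ)`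
(plate t48-K″, nsreg-p2 g36 ROUND-46 «THE KINEMATIC CEILING» §1, `r46/Sketch46.lean` `NsregP2.R46.ThinWindowGapLiouville`)

Width piece for crux `EulerZoomLiouville.PowerGaugeEulerLiouville` (stmt-NavierStokesRegularity-19832), by name under LEAD 19832
(ns-typeII-p2 g13); seat ns-sfl-p1 g7, `--supports stmt-NavierStokesRegularity-19832 --as helper`.

Binders verbatim THEOREM K′ (`Condenser.sharpExplicitGapLiouville`, p671279) except the smallness hypothesis: for SOME
`c' < κ⋆⋆(c,ρ) := 2π/((1−ρ)²(2+ρ)c)` the bound `‖DV‖ ≤ exp(c' R^{2+ρ})` holds on `B(0,R)` for ALL `R ≥ R₀` — then `u = 0` a.e.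
(K′: the same along SOME sequence `R → ∞` with `c' < κ⋆ = 2π/(3(1−ρ)(2+ρ)c)`; `κ⋆⋆/κ⋆ = 3/(1−ρ) ∈ (3, 6]`.)

Proof (ROUND-46 §1(a)–(d)): thin windows `[ℓ, qℓ]`, `q ↓ 1`.  With `γ = 1/(2+ρ)`, `C_A = c`, `C_E = (1−ρ)γc`
(`NeedleThinCore.selfSimilar_needle_inputs` + `NeedleRace.lintegral_fderiv_sq_closedBall_le`), `F(t) = ∫_{B(0,t)}‖DV‖² ≤ C_E t^{1−ρ}`
(`t ≥ 1`).  WLOG `c' > 0`; pick `θ ∈ (c'/κ⋆⋆, 1)` and `q > 1` with `c' q^{2+ρ} < θκ⋆⋆` (continuity at `q = 1`), and `R₁` from the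
shell condenser in gauge form (B″_g) `Condenser.shellCondenserGaugeForm` (p-file `…CondenserShellCondenserGaugeForm`).  Fix `x` with
`curl V x ≠ 0` and `R = max(R₁, 1, R₀, ‖x‖+1)`.  For EVERY `ℓ ≥ R`: the cut-off copy `V_c = V` on `B(0,(q+1)ℓ)`
(`Loc.exists_cutoff_local`) must have a backward orbit from `B(0,ℓ)` reaching `‖·‖ = qℓ` (else `curl V x = 0` by K′'s
`Condenser.curl_eq_zero_of_noexit`); (B″_g) with any shell budget `S ≥ S_ℓ = F(qℓ) − F(ℓ)` puts `exp(θ2πγ²(q³−1)ℓ³/(3S)) ≤ ‖DV(z)‖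
≤ exp(c'(qℓ)^{2+ρ})` at some `z ∈ B(0,qℓ)`, whence `S_ℓ ≥ a ℓ^{1−ρ}`, `a = θ2πγ²(q³−1)/(3c'q^{2+ρ})`.  The telescoping budget lemma
(W2) `Condenser.telescopingBudget_of` (p678155) then gives `a ≤ C_E(q^{1−ρ} − 1) ≤ C_E(1−ρ)(q−1)` (Bernoulli,
`rpow_one_add_le_one_add_mul_self`), while `a ≥ θ2πγ²(q−1)/(c'q^{2+ρ})` (`q³−1 ≥ 3(q−1)`): this says `θκ⋆⋆ ≤ c'q^{2+ρ}`
(`κ⋆⋆ = 2πγ²/((1−ρ)C_E)`), contradicting the choice of `q`.  Hence `curl V ≡ 0` and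
`Loc.selfSimilar_ae_eq_zero_of_irrotationalC2_profile` concludes.

* `selfSimilar_ae_eq_zero_of_thinWindowSmallTypeGradientC2` — THEOREM K″ with implicit binders;
* `thinWindowGapLiouville` — the Sketch46 text VERBATIM.

NUMBERS OF RECORD: at `c = 1`: `κ⋆⋆(½) = 10.05`, `κ⋆⋆(¼) = 4.96`, `κ⋆⋆(0⁺) = π`; K′: `κ⋆(1,½) = 1.676`.
HONEST FRAMING: a stratum of the crux CLASS (hypothetical blow-up members, MODEL lattice); nothing here proves the crux E
(19832 OPEN), any door Target, or Navier–Stokes regularity. [nsreg-p2 ROUND-46 THEOREM K″;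
cite: ConstantinIgnatovaVicol2026Putative, §3.4.1; folklore (length–area method)]
-/

noncomputable section

open Set Filter Topology Metric Function MeasureTheory Real
open scoped RealInnerProductSpace NNReal ENNReal

set_option linter.dupNamespace false

namespace Summit.NavierStokesRegularity.NavierStokesRegularity.Theorems.PowerGaugeEulerLiouville.Condenser

open Literature.Analysis Literature.Analysis.FluidPDE
open Summit.NavierStokesRegularity.NavierStokesRegularity.Theorems.PowerGaugeEulerLiouville

/-! ## Bookkeeping -/

/-- Choice of the window ratio: if `c' < θκ`, some `q ∈ (1, 2]` still has `c' q^{2+ρ} < θκ` (`2+ρ > 0`; continuity of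
`q ↦ q^{2+ρ}` at `q = 1`). [folklore] -/
theorem exists_window_ratio {c' θ κ ρ : ℝ} (h2ρ : 0 < 2 + ρ) (h : c' < θ * κ) :
    ∃ q : ℝ, 1 < q ∧ q ≤ 2 ∧ c' * q ^ (2 + ρ) < θ * κ := by
  set f : ℝ → ℝ := fun q => c' * q ^ (2 + ρ) with hf
  have hfc : Continuous f := continuous_const.mul (Real.continuous_rpow_const h2ρ.le)
  have hf1 : f 1 = c' := by simp [hf]
  have hev : ∀ᶠ q in 𝓝 (1 : ℝ), f q < θ * κ := hfc.continuousAt.eventually (gt_mem_nhds (by rw [hf1]; exact h))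
  obtain ⟨ε, hε, hball⟩ := Metric.eventually_nhds_iff.1 hev
  refine ⟨1 + min (ε / 2) 1, lt_add_of_pos_right 1 (lt_min (half_pos hε) one_pos),
    by linarith [min_le_right (ε / 2) 1], ?_⟩
  have hq := hball (y := 1 + min (ε / 2) 1) (by
    rw [Real.dist_eq, add_sub_cancel_left, abs_of_pos (by positivity)]
    exact (min_le_left _ _).trans_lt (by linarith))
  simpa only [hf] using hq

/-- The shell of the window `[ℓ, qℓ]` inside `B(0,qℓ)` is the set difference of the two balls. [folklore] -/
theorem ball_sdiff_ball_eq_shell (ℓ q : ℝ) :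
    ball (0 : EuclideanSpace ℝ (Fin 3)) (q * ℓ) \ ball (0 : EuclideanSpace ℝ (Fin 3)) ℓ =
      ball (0 : EuclideanSpace ℝ (Fin 3)) (q * ℓ) ∩ {x | ℓ ≤ ‖x‖} := by
  ext x
  simp [mem_ball, dist_zero_right, not_lt]

/-- The final arithmetic of THEOREM K″: `a = θ2πγ²(q³−1)/(3c'Q) ≤ C_E(q^{1−ρ}−1)` is incompatible with `c'Q < θκ⋆⋆`,
`κ⋆⋆(1−ρ)C_E = 2πγ²` (`Q = q^{2+ρ} > 0`, `q > 1`, `0 ≤ ρ < 1`, Bernoulli `q^{1−ρ} ≤ 1 + (1−ρ)(q−1)`, `q³−1 ≥ 3(q−1)`). [folklore] -/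
theorem thinWindow_absurd {θ γ q c' Q CE κ ρ : ℝ} (hθ : 0 < θ) (hq : 1 < q) (hc' : 0 < c') (hQ : 0 < Q)
    (hCE : 0 < CE) (hρ : 0 ≤ ρ) (hρ1 : ρ < 1)
    (hκid : κ * ((1 - ρ) * CE) = 2 * Real.pi * γ ^ 2) (hqθ : c' * Q < θ * κ)
    (hW : θ * (2 * Real.pi * γ ^ 2 * (q ^ 3 - 1)) / (3 * c' * Q) ≤ CE * (q ^ (1 - ρ) - 1)) : False := by
  have hπ : 0 < Real.pi := Real.pi_pos
  -- Bernoulli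
  have hB := rpow_one_add_le_one_add_mul_self (s := q - 1) (by linarith) (p := 1 - ρ) (by linarith) (by linarith)
  rw [show (1 : ℝ) + (q - 1) = q by ring] at hB
  have hq3 : 3 * (q - 1) ≤ q ^ 3 - 1 := by nlinarith [mul_pos (sub_pos.2 hq) (sub_pos.2 hq)]
  -- clear the denominator
  rw [div_le_iff₀ (by positivity)] at hW
  have h1 : CE * (q ^ (1 - ρ) - 1) * (3 * c' * Q) ≤ CE * ((1 - ρ) * (q - 1)) * (3 * c' * Q) :=
    mul_le_mul_of_nonneg_right (mul_le_mul_of_nonneg_left (by linarith) hCE.le) (by positivity)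
  have h2 : θ * (2 * Real.pi * γ ^ 2 * (3 * (q - 1))) ≤ θ * (2 * Real.pi * γ ^ 2 * (q ^ 3 - 1)) :=
    mul_le_mul_of_nonneg_left (mul_le_mul_of_nonneg_left hq3 (by positivity)) hθ.le
  -- `θ2πγ² ≤ c'Q(1−ρ)C_E` after dividing by `3(q−1) > 0`
  have h3 : θ * (2 * Real.pi * γ ^ 2) * (3 * (q - 1)) ≤ c' * Q * ((1 - ρ) * CE) * (3 * (q - 1)) := by
    have := (h2.trans hW).trans h1
    nlinarith [this]
  have h4 : θ * (2 * Real.pi * γ ^ 2) ≤ c' * Q * ((1 - ρ) * CE) :=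
    le_of_mul_le_mul_right h3 (by linarith)
  -- but `c'Q(1−ρ)C_E < θκ(1−ρ)C_E = θ2πγ²`
  have h5 : c' * Q * ((1 - ρ) * CE) < θ * κ * ((1 - ρ) * CE) :=
    mul_lt_mul_of_pos_right hqθ (mul_pos (by linarith) hCE)
  rw [mul_assoc θ κ, hκid] at h5
  linarith

/-! ## THEOREM K″ -/

/-- **THEOREM K″ — ONE SUB-`κ⋆⋆` OUTER TYPE AT ALL LARGE RADII KILLS.**  See the module docstring.
[nsreg-p2 ROUND-46 THEOREM K″; cite: ConstantinIgnatovaVicol2026Putative, §3.4.1; folklore (length–area method)] -/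
theorem selfSimilar_ae_eq_zero_of_thinWindowSmallTypeGradientC2 {ρ : ℝ} (hρ : 0 < ρ) (hρ1 : ρ ≤ 1 / 2)
    {u : ℝ → EuclideanSpace ℝ (Fin 3) → EuclideanSpace ℝ (Fin 3)} {p : ℝ → EuclideanSpace ℝ (Fin 3) → ℝ}
    {H : ℝ → EuclideanSpace ℝ (Fin 3) → EuclideanSpace ℝ (Fin 3) →L[ℝ] EuclideanSpace ℝ (Fin 3)} {c : ℝ≥0}
    (hc : 0 < (c : ℝ))
    (hsw : IsSuitableWeakSolutionOn (slab (EuclideanSpace ℝ (Fin 3)) (Iio 0) isOpen_Iio) 0 0 u p)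
    (hH : HasWeakSpatialGradientOn (slab (EuclideanSpace ℝ (Fin 3)) (Iio 0) isOpen_Iio) u H)
    (hgauge : ∀ a : ℝ, 0 < a →
      ENNReal.ofReal (a ^ (2 * ρ)) * cknA a (0 : ℝ × EuclideanSpace ℝ (Fin 3)) u +
          ENNReal.ofReal (a ^ ρ) * cknE a (0 : ℝ × EuclideanSpace ℝ (Fin 3)) H +
        ENNReal.ofReal (a ^ (2 * ρ)) * cknD a (0 : ℝ × EuclideanSpace ℝ (Fin 3)) p ≤ (c : ℝ≥0∞))
    {V : EuclideanSpace ℝ (Fin 3) → EuclideanSpace ℝ (Fin 3)} {P : EuclideanSpace ℝ (Fin 3) → ℝ}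
    (hu : ∀ τ : ℝ, τ < 0 → u τ = selfSimilarCollapse (1 / (2 + ρ)) 0 V τ)
    (hp : ∀ τ : ℝ, τ < 0 → p τ = selfSimilarCollapsePressure (1 / (2 + ρ)) 0 P τ)
    (hV : ContDiff ℝ 2 V)
    (hgrad : ∃ c' : ℝ, c' < 2 * Real.pi / ((1 - ρ) ^ 2 * (2 + ρ) * (c : ℝ)) ∧
      ∃ R₀ : ℝ, ∀ R : ℝ, R₀ ≤ R →
        ∀ z ∈ ball (0 : EuclideanSpace ℝ (Fin 3)) R, ‖fderiv ℝ V z‖ ≤ Real.exp (c' * R ^ (2 + ρ))) :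
    uncurry u =ᵐ[volume.restrict (Iio (0 : ℝ) ×ˢ (univ : Set (EuclideanSpace ℝ (Fin 3))))] 0 := by
  obtain ⟨c₀, hc₀κ, R₀, hgrad⟩ := hgrad
  have hπ : 0 < Real.pi := Real.pi_pos
  have hρ1' : ρ < 1 := by linarith
  have h2ρ : (0 : ℝ) < 2 + ρ := by linarith
  have h1ρ : (0 : ℝ) < 1 - ρ := by linarith
  have hγ : (0 : ℝ) < 1 / (2 + ρ) := one_div_pos.2 h2ρ
  have hγ2 : 1 / (2 + ρ) < 1 / 2 := one_div_lt_one_div_of_lt two_pos (by linarith)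
  have hV1 : ContDiff ℝ 1 V := hV.of_le (by norm_num)
  -- ### a classical pressure for the profile
  have hA : ∀ a : ℝ, 0 < a → ENNReal.ofReal (a ^ (2 * ρ)) *
      cknA a (0 : ℝ × EuclideanSpace ℝ (Fin 3)) u ≤ (c : ℝ≥0∞) :=
    fun a ha => le_trans (le_trans le_self_add le_self_add) (hgauge a ha)
  have hD : ∀ a : ℝ, 0 < a → ENNReal.ofReal (a ^ (2 * ρ)) *
      cknD a (0 : ℝ × EuclideanSpace ℝ (Fin 3)) p ≤ (c : ℝ≥0∞) :=
    fun a ha => le_trans le_add_self (hgauge a ha)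
  have hpm : AEStronglyMeasurable (uncurry p)
      (volume.restrict (Iio (0 : ℝ) ×ˢ (univ : Set (EuclideanSpace ℝ (Fin 3))))) := by
    have := hsw.distributional.2.2.1.aestronglyMeasurable
    simpa [slab] using this
  have hPm := aestronglyMeasurable_pressureProfile hpm hp
  have hDprof := profile_pressure_weight_of_gaugeD hρ hρ1' hpm hp hD
  have hP1 : LocallyIntegrable P volume :=
    EnergySaturation.locallyIntegrable_pressure_of_weight hρ1' hPm
      (ENNReal.mul_ne_top ENNReal.ofReal_ne_top ENNReal.coe_ne_top) hDprof
  obtain ⟨P', hprof⟩ :=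
    WeakToClassical.exists_isSelfSimilarEulerProfile_of_contDiff hsw.distributional hu hp hV hP1
  -- ### the class budgets of the profile on balls (`0 < c`)
  obtain ⟨hA', hE'⟩ :=
    NeedleThinCore.selfSimilar_needle_inputs hρ hρ1' hsw hH hgauge hu hp hV1
  obtain ⟨CA, hCA⟩ : ∃ CA : ℝ, CA = (c : ℝ) := ⟨_, rfl⟩
  obtain ⟨CE, hCE⟩ : ∃ CE : ℝ, CE = (1 - ρ) / (2 + ρ) * (c : ℝ) := ⟨_, rfl⟩
  have hE0 : 0 ≤ (1 - ρ) / (2 + ρ) * (c : ℝ) := by positivity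
  have hCApos : 0 < CA := by rw [hCA]; exact hc
  have hCEpos : 0 < CE := by rw [hCE]; positivity
  have hbA : ∀ r : ℝ, 0 < r →
      ∫ x in ball (0 : EuclideanSpace ℝ (Fin 3)) r, ‖V x‖ ^ 2 ≤ CA * r ^ (1 - 2 * ρ) := by
    intro r hr
    have hX : 0 ≤ CA * r ^ (1 - 2 * ρ) := by positivity
    refine setIntegral_sq_le_of_lintegral hV.continuous hX ((hA' r hr).trans ?_)
    rw [hCA, ← ENNReal.ofReal_coe_nnreal, ← ENNReal.ofReal_mul (NNReal.coe_nonneg c)]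
  have hbE : ∀ r : ℝ, 1 ≤ r →
      ∫ x in ball (0 : EuclideanSpace ℝ (Fin 3)) r, ‖fderiv ℝ V x‖ ^ 2 ≤ CE * r ^ (1 - ρ) := by
    intro r hr
    have hr0 : (0 : ℝ) < r := by linarith
    have h1 := NeedleRace.lintegral_fderiv_sq_closedBall_le hρ1' hE0 hE' hr
    have h2 : ∫⁻ z in ball (0 : EuclideanSpace ℝ (Fin 3)) r, ‖fderiv ℝ V z‖ₑ ^ 2 ≤
        ENNReal.ofReal ((1 - ρ) / (2 + ρ) * (c : ℝ) * r ^ (1 - ρ)) :=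
      (lintegral_mono_set ball_subset_closedBall).trans h1
    have hY : 0 ≤ CE * r ^ (1 - ρ) := by positivity
    rw [hCE]
    exact setIntegral_sq_le_of_lintegral (hV.continuous_fderiv (by norm_num)) (by rw [← hCE]; exact hY) h2
  -- ### the threshold `κ⋆⋆`, WLOG `c' > 0`, the parameters `θ`, `q`
  obtain ⟨κss, hκss⟩ : ∃ κss : ℝ, κss = 2 * Real.pi / ((1 - ρ) ^ 2 * (2 + ρ) * (c : ℝ)) := ⟨_, rfl⟩
  rw [← hκss] at hc₀κ
  have hκss0 : 0 < κss := by rw [hκss]; positivity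
  have hκid : κss * ((1 - ρ) * CE) = 2 * Real.pi * (1 / (2 + ρ)) ^ 2 := by
    rw [hκss, hCE]
    field_simp
  obtain ⟨c', hc'def⟩ : ∃ c' : ℝ, c' = max c₀ (κss / 2) := ⟨_, rfl⟩
  have hc'pos : 0 < c' := by rw [hc'def]; exact lt_max_of_lt_right (by linarith)
  have hc'κ : c' < κss := by rw [hc'def]; exact max_lt hc₀κ (by linarith)
  have hc₀c' : c₀ ≤ c' := by rw [hc'def]; exact le_max_left _ _
  obtain ⟨θ, hθdef⟩ : ∃ θ : ℝ, θ = (1 + c' / κss) / 2 := ⟨_, rfl⟩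
  have hcκ : c' / κss < 1 := (div_lt_one hκss0).2 hc'κ
  have hcκ0 : 0 < c' / κss := div_pos hc'pos hκss0
  have hθ0 : 0 < θ := by rw [hθdef]; positivity
  have hθ1 : θ < 1 := by rw [hθdef]; linarith
  have hθc : c' < θ * κss := by
    have : c' / κss < θ := by rw [hθdef]; linarith
    rwa [div_lt_iff₀ hκss0] at this
  obtain ⟨q, hq, hq2, hqθ⟩ := exists_window_ratio (ρ := ρ) h2ρ hθc
  have hq0 : 0 < q := by linarith
  have hQ : 0 < q ^ (2 + ρ) := Real.rpow_pos_of_pos hq0 _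
  -- ### the shell condenser in gauge form at `(γ, ρ, C_A, q, θ)`
  obtain ⟨R₁, hR₁, hBg⟩ := shellCondenserGaugeForm (1 / (2 + ρ)) ρ CA q θ hγ hρ.le hCApos hq hθ0 hθ1
  -- the window constant `a` and the Dirichlet counting function `F`
  obtain ⟨a, hadef⟩ : ∃ a : ℝ, a = θ * (2 * Real.pi * (1 / (2 + ρ)) ^ 2 * (q ^ 3 - 1)) / (3 * c' * q ^ (2 + ρ)) :=
    ⟨_, rfl⟩
  have hq3 : 0 < q ^ 3 - 1 := by nlinarith [pow_lt_pow_left₀ hq zero_le_one three_ne_zero]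
  have hapos : 0 < a := by rw [hadef]; positivity
  set F : ℝ → ℝ := fun t => ∫ z in ball (0 : EuclideanSpace ℝ (Fin 3)) t, ‖fderiv ℝ V z‖ ^ 2 with hF
  have hDVc : Continuous fun z => ‖fderiv ℝ V z‖ ^ 2 := (hV.continuous_fderiv (by norm_num)).norm.pow 2
  have hFint : ∀ t : ℝ, IntegrableOn (fun z => ‖fderiv ℝ V z‖ ^ 2) (ball (0 : EuclideanSpace ℝ (Fin 3)) t) volume :=
    fun t => (hDVc.continuousOn.integrableOn_compact (isCompact_closedBall 0 t)).mono_set ball_subset_closedBall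
  have hF0 : ∀ t, 0 ≤ F t := fun t => setIntegral_nonneg measurableSet_ball fun z _ => sq_nonneg _
  -- ### the profile is irrotational
  have hcurl : ∀ x : EuclideanSpace ℝ (Fin 3), curl V x = 0 := by
    intro x
    by_contra hxc
    -- the base radius
    obtain ⟨R, hRdef⟩ : ∃ R : ℝ, R = max (max R₁ 1) (max R₀ (‖x‖ + 1)) := ⟨_, rfl⟩
    have hRR₁ : R₁ ≤ R := by rw [hRdef]; exact (le_max_left _ _).trans (le_max_left _ _)
    have hR1 : 1 ≤ R := by rw [hRdef]; exact (le_max_right _ _).trans (le_max_left _ _)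
    have hRR₀ : R₀ ≤ R := by rw [hRdef]; exact (le_max_left _ _).trans (le_max_right _ _)
    have hRx : ‖x‖ + 1 ≤ R := by rw [hRdef]; exact (le_max_right _ _).trans (le_max_right _ _)
    have hR0 : 0 < R := by linarith
    -- every window `[ℓ, qℓ]`, `ℓ ≥ R`, pays `a ℓ^{1−ρ}`
    have hwin : ∀ ℓ : ℝ, R ≤ ℓ → a * ℓ ^ (1 - ρ) ≤ F (q * ℓ) - F ℓ := by
      intro ℓ hℓ
      have hℓ0 : 0 < ℓ := hR0.trans_le hℓ
      have hℓ1 : 1 ≤ ℓ := hR1.trans hℓ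
      have hqℓ : ℓ ≤ q * ℓ := le_mul_of_one_le_left hℓ0.le hq.le
      -- the shell budget `S_ℓ = F(qℓ) − F(ℓ)`
      have hshell : F (q * ℓ) - F ℓ =
          ∫ z in ball (0 : EuclideanSpace ℝ (Fin 3)) (q * ℓ) ∩ {x | ℓ ≤ ‖x‖}, ‖fderiv ℝ V z‖ ^ 2 := by
        rw [← ball_sdiff_ball_eq_shell, setIntegral_sdiff measurableSet_ball (hFint _) (ball_subset_ball hqℓ)]
      have hSℓ0 : 0 ≤ ∫ z in ball (0 : EuclideanSpace ℝ (Fin 3)) (q * ℓ) ∩ {x | ℓ ≤ ‖x‖}, ‖fderiv ℝ V z‖ ^ 2 :=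
        setIntegral_nonneg (measurableSet_ball.inter (measurableSet_le measurable_const continuous_norm.measurable))
          fun z _ => sq_nonneg _
      by_contra hlt
      push Not at hlt
      rw [hshell] at hlt
      -- a budget `S` strictly between `S_ℓ` and `a ℓ^{1−ρ}`
      obtain ⟨S, hSdef⟩ : ∃ S : ℝ, S =
          ((∫ z in ball (0 : EuclideanSpace ℝ (Fin 3)) (q * ℓ) ∩ {x | ℓ ≤ ‖x‖}, ‖fderiv ℝ V z‖ ^ 2) +
            a * ℓ ^ (1 - ρ)) / 2 := ⟨_, rfl⟩
      have haℓ : 0 < a * ℓ ^ (1 - ρ) := mul_pos hapos (Real.rpow_pos_of_pos hℓ0 _)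
      have hS : 0 < S := by rw [hSdef]; linarith
      have hSℓS : (∫ z in ball (0 : EuclideanSpace ℝ (Fin 3)) (q * ℓ) ∩ {x | ℓ ≤ ‖x‖}, ‖fderiv ℝ V z‖ ^ 2) ≤ S := by
        rw [hSdef]; linarith
      have hSa : S < a * ℓ ^ (1 - ρ) := by rw [hSdef]; linarith
      -- a `C²` cut-off copy agreeing with `V` on `B(0,(q+1)ℓ)`
      obtain ⟨Vc, hVc2, -, -, ⟨K, hK⟩, hVU⟩ := Loc.exists_cutoff_local hV (R := (q + 1) * ℓ) (by positivity)
      have hVc1 : ContDiff ℝ 1 Vc := hVc2.of_le (by norm_num)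
      have hsub : ball (0 : EuclideanSpace ℝ (Fin 3)) (q * ℓ) ⊆ ball (0 : EuclideanSpace ℝ (Fin 3)) ((q + 1) * ℓ) :=
        ball_subset_ball (by linarith)
      have hfd : ∀ z ∈ ball (0 : EuclideanSpace ℝ (Fin 3)) ((q + 1) * ℓ), fderiv ℝ Vc z = fderiv ℝ V z := fun z hz =>
        Filter.EventuallyEq.fderiv_eq (Filter.eventually_of_mem (isOpen_ball.mem_nhds hz) hVU)
      -- an exit from `B(0,ℓ)` through `‖·‖ = qℓ` must exist, else `curl V x = 0`
      have hex : ∃ (y : EuclideanSpace ℝ (Fin 3)) (L : ℝ), ‖y‖ < ℓ ∧ 0 ≤ L ∧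
          q * ℓ ≤ ‖ODE.evolutionMap (fun _ : ℝ => selfSimilarTransport (1 / (2 + ρ)) 0 Vc) 0 (-L) y‖ := by
        by_contra hne
        push Not at hne
        exact hxc (curl_eq_zero_of_noexit hprof hγ hγ2 hV hVc1 hK hℓ0 hq hVU
          (fun y hy L hL => hne y L hy hL) (by linarith))
      obtain ⟨y, L, hy, hL, hexit⟩ := hex
      -- budgets of the cut-off copy: amplitude on `B(0,qℓ)`, energy `≤ S` on the shell
      have hAc : ∫ z in ball (0 : EuclideanSpace ℝ (Fin 3)) (q * ℓ), ‖Vc z‖ ^ 2 ≤ CA * (q * ℓ) ^ (1 - 2 * ρ) := by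
        rw [setIntegral_congr_fun measurableSet_ball (fun z hz => by rw [hVU z (hsub hz)])]
        exact hbA _ (by positivity)
      have hEc : ∫ z in ball (0 : EuclideanSpace ℝ (Fin 3)) (q * ℓ) ∩ {x : EuclideanSpace ℝ (Fin 3) | ℓ ≤ ‖x‖},
          ‖fderiv ℝ Vc z‖ ^ 2 ≤ S := by
        rw [setIntegral_congr_fun
          (measurableSet_ball.inter (measurableSet_le measurable_const continuous_norm.measurable))
          (fun z hz => by rw [hfd z (hsub hz.1)])]
        exact hSℓS
      -- (B″_g): an exponential gradient inside `B(0,qℓ)` … under the envelope at radius `qℓ`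
      obtain ⟨z, hz, hzle⟩ := hBg Vc K hVc1 hK ℓ S (hRR₁.trans hℓ) hS hAc hEc y L hL hy hexit
      rw [hfd z (hsub hz)] at hzle
      have hqℓ0 : 0 < q * ℓ := by positivity
      have henv : ‖fderiv ℝ V z‖ ≤ Real.exp (c' * (q * ℓ) ^ (2 + ρ)) := by
        refine (hgrad (q * ℓ) (hRR₀.trans (hℓ.trans hqℓ)) z hz).trans (Real.exp_le_exp.2 ?_)
        exact mul_le_mul_of_nonneg_right hc₀c' (Real.rpow_nonneg hqℓ0.le _)
      have hineq := Real.exp_le_exp.1 (hzle.trans henv)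
      rw [Real.mul_rpow hq0.le hℓ0.le, mul_div_assoc', div_le_iff₀ (by positivity : (0 : ℝ) < 3 * S)] at hineq
      -- `a ℓ^{1−ρ} ≤ S`, contradicting `S < a ℓ^{1−ρ}`
      have hℓ3 : ℓ ^ (2 + ρ) * ℓ ^ (1 - ρ) = ℓ ^ 3 := by
        rw [← Real.rpow_add hℓ0, show (2 + ρ) + (1 - ρ) = ((3 : ℕ) : ℝ) by push_cast; ring, Real.rpow_natCast]
      have hℓQ : 0 < ℓ ^ (2 + ρ) := Real.rpow_pos_of_pos hℓ0 _
      have hfin : a * ℓ ^ (1 - ρ) ≤ S := by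
        rw [hadef, div_mul_eq_mul_div, div_le_iff₀ (by positivity)]
        refine le_of_mul_le_mul_right ?_ hℓQ
        calc θ * (2 * Real.pi * (1 / (2 + ρ)) ^ 2 * (q ^ 3 - 1)) * ℓ ^ (1 - ρ) * ℓ ^ (2 + ρ)
            = θ * (2 * Real.pi * (1 / (2 + ρ)) ^ 2 * (q ^ 3 - 1)) * (ℓ ^ (2 + ρ) * ℓ ^ (1 - ρ)) := by ring
          _ = θ * (2 * Real.pi * (1 / (2 + ρ)) ^ 2 * (q ^ 3 - 1) * ℓ ^ 3) := by rw [hℓ3]; ring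
          _ ≤ c' * (q ^ (2 + ρ) * ℓ ^ (2 + ρ)) * (3 * S) := hineq
          _ = S * (3 * c' * q ^ (2 + ρ)) * ℓ ^ (2 + ρ) := by ring
      linarith
    -- (W2): the windows cannot all be paid from `F(t) ≤ C_E t^{1−ρ}`
    have hW := telescopingBudget_of (F := F) (C := CE) hρ1' hq hR0 (fun t _ => hF0 t)
      (fun t ht => hbE t (hR1.trans ht)) hwin
    rw [hadef] at hW
    exact thinWindow_absurd hθ0 hq hc'pos hQ hCEpos hρ.le hρ1' hκid hqθ hW
  -- ### conclusion
  exact Loc.selfSimilar_ae_eq_zero_of_irrotationalC2_profile hρ hsw.distributional hA hu hV hcurl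

/-- **`NsregP2.R46.ThinWindowGapLiouville`, binder-for-binder** (Sketch46 of nsreg-p2 g36, sha16 7c4c548940e39666, plate t48-K″;
`E3 = EuclideanSpace ℝ (Fin 3)` spelled out). [nsreg-p2 ROUND-46 THEOREM K″; cite: ConstantinIgnatovaVicol2026Putative, §3.4.1;
folklore (length–area method)] -/
theorem thinWindowGapLiouville :
    ∀ (ρ : ℝ), 0 < ρ → ρ ≤ 1 / 2 →
    ∀ (u : ℝ → EuclideanSpace ℝ (Fin 3) → EuclideanSpace ℝ (Fin 3)) (p : ℝ → EuclideanSpace ℝ (Fin 3) → ℝ)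
      (H : ℝ → EuclideanSpace ℝ (Fin 3) → EuclideanSpace ℝ (Fin 3) →L[ℝ] EuclideanSpace ℝ (Fin 3)) (c : ℝ≥0),
      0 < (c : ℝ) →
      IsSuitableWeakSolutionOn (slab (EuclideanSpace ℝ (Fin 3)) (Iio 0) isOpen_Iio) 0 0 u p →
      HasWeakSpatialGradientOn (slab (EuclideanSpace ℝ (Fin 3)) (Iio 0) isOpen_Iio) u H →
      (∀ a : ℝ, 0 < a →
        ENNReal.ofReal (a ^ (2 * ρ)) * cknA a (0 : ℝ × EuclideanSpace ℝ (Fin 3)) u +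
            ENNReal.ofReal (a ^ ρ) * cknE a (0 : ℝ × EuclideanSpace ℝ (Fin 3)) H +
          ENNReal.ofReal (a ^ (2 * ρ)) * cknD a (0 : ℝ × EuclideanSpace ℝ (Fin 3)) p ≤ (c : ℝ≥0∞)) →
      ∀ (V : EuclideanSpace ℝ (Fin 3) → EuclideanSpace ℝ (Fin 3)) (P : EuclideanSpace ℝ (Fin 3) → ℝ),
        (∀ τ : ℝ, τ < 0 → u τ = selfSimilarCollapse (1 / (2 + ρ)) 0 V τ) →
        (∀ τ : ℝ, τ < 0 → p τ = selfSimilarCollapsePressure (1 / (2 + ρ)) 0 P τ) →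
        ContDiff ℝ 2 V →
        (∃ c' : ℝ, c' < 2 * Real.pi / ((1 - ρ) ^ 2 * (2 + ρ) * (c : ℝ)) ∧
          ∃ R₀ : ℝ, ∀ R : ℝ, R₀ ≤ R →
            ∀ z ∈ ball (0 : EuclideanSpace ℝ (Fin 3)) R, ‖fderiv ℝ V z‖ ≤ Real.exp (c' * R ^ (2 + ρ))) →
        uncurry u =ᵐ[volume.restrict (Iio (0 : ℝ) ×ˢ (univ : Set (EuclideanSpace ℝ (Fin 3))))] 0 :=
  fun _ hρ hρ1 _ _ _ _ hc hsw hH hgauge _ _ hu hp hV hgrad =>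
    selfSimilar_ae_eq_zero_of_thinWindowSmallTypeGradientC2 hρ hρ1 hc hsw hH hgauge hu hp hV hgrad

end Summit.NavierStokesRegularity.NavierStokesRegularity.Theorems.PowerGaugeEulerLiouville.Condenser

end
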